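import Literature.RingTheory.CohomologyAnnihilator.StableAnnihilation
import Literature.RingTheory.CohomologyAnnihilator.TowerBasic
import HarnessLib

/-!
# Crux `NoZenoR` (stmt-ResolutionOfSingularities-19943), census row 8N / target T_ST — the CYCLIC CEILING
# for the first cohomology annihilator: `ca¹(R) ⊆ ⋂_I (I + ann I)`

Route `ResolutionOfSingularities/HomologicalConductor`, chain W4.4, KERNEL-g22 §2 (lead g22). `[OURS]` —
AI-formalised, weaker than expert review; NOT a statement of any manuscript under review.

For a commutative ring `R`, an ideal `I` and `c : R`, consider the short exact sequence
`Q(I) : 0 → I → R → R/I → 0` of `R`-modules. We prove the elementary splitting computation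

* `exists_lift_smul_iff`: the homothety `c • 𝟙 (R/I)` lifts along `R → R/I` iff `c ∈ I ⊔ ann I`
  (a lift `ψ` gives `r = ψ 1̄` with `I • r = 0` and `r - c ∈ I`; conversely `s̄ ↦ s • r` is a lift);
* `smul_ext_quotient_eq_zero_of_mem_sup_annihilator`: every `c ∈ I ⊔ ann I` kills `Extⁱ(R/I, N)` for
  all `R`-modules `N` and all `i ≥ 1` (the lift factors `c • 𝟙` through the free module `R`);
* `smul_extClass_eq_zero_iff_mem_sup_annihilator`: `c • [Q(I)] = 0` in `Ext¹(R/I, I)` iff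
  `c ∈ I ⊔ ann I` (splitting criterion of `Literature/…/StableAnnihilation`);
* `mem_sup_annihilator_of_mem_cohomologyAnnihilatorOfDegree_one`: if `I` is finitely generated and
  `c ∈ ca¹(R)` (Iyengar–Takahashi) then `c ∈ I ⊔ ann I`; hence, for noetherian `R`,
  `ca¹(R) ≤ ⨅_I (I ⊔ ann I)` (`cohomologyAnnihilatorOfDegree_one_le_iInf_sup_annihilator`).

Use (KERNEL-g22 THEOREM 22.2 (a), the ceiling half of the dimension-zero counterexample to
«ca = ca^{dim+1}»): for `R = k[x,y]/(x,y)³` one has `ann(x) = (x,y)²`, so `y ∉ (x) + ann(x)` and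
`y ∉ ca¹(R)` (`not_mem_cohomologyAnnihilatorOfDegree_one_of_not_mem_sup_annihilator`), while
`(x,y)² ⊆ ca¹(R)`; the floor half `(x,y) ⊆ ca²(R)` is KERNEL-g22 §2 (b) (not typed here).
-/

noncomputable section

-- single-problem summit: the doubled namespace component is forced
set_option linter.dupNamespace false

open CategoryTheory CategoryTheory.Abelian CategoryTheory.Limits
open Literature.RingTheory.CohomologyAnnihilator

universe u

namespace Summit.ResolutionOfSingularities.ResolutionOfSingularities.Theorems.NoZeno.CyclicCeiling

variable {R : Type u} [CommRing R] (I : Ideal R)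

/-- `Ī = 0` in `R/I`: the composite `I → R → R/I` vanishes. [folklore] -/
theorem mkQ_comp_subtype : (I.mkQ).comp I.subtype = 0 := by
  apply LinearMap.ext
  intro x
  rw [LinearMap.comp_apply, LinearMap.zero_apply, Submodule.subtype_apply, Submodule.mkQ_apply,
    Submodule.Quotient.mk_eq_zero]
  exact x.2

/-- `Ī = 0` in `R/I`, at the level of `ModuleCat R`: `(I → R) ≫ (R → R/I) = 0`. [folklore] -/
theorem subtype_comp_mkQ_eq_zero :
    ModuleCat.ofHom I.subtype ≫ ModuleCat.ofHom I.mkQ = (0 : ModuleCat.of R I ⟶ ModuleCat.of R (R ⧸ I)) := by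
  rw [← ModuleCat.ofHom_comp, mkQ_comp_subtype]; rfl

/-- The short complex `Q(I) : 0 → I → R → R/I → 0` of `R`-modules (no new definition is introduced:
it is the term `ShortComplex.mk (ofHom I.subtype) (ofHom I.mkQ) (subtype_comp_mkQ_eq_zero I)`) is short
exact. [folklore] -/
theorem quotientSeq_shortExact :
    (ShortComplex.mk (ModuleCat.ofHom I.subtype) (ModuleCat.ofHom I.mkQ)
      (subtype_comp_mkQ_eq_zero I)).ShortExact := by
  have hex : Function.Exact I.subtype I.mkQ := by
    intro x
    constructor
    · intro hx
      exact ⟨⟨x, (Submodule.Quotient.mk_eq_zero I).mp hx⟩, rfl⟩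
    · rintro ⟨y, rfl⟩
      exact (Submodule.Quotient.mk_eq_zero I).mpr y.2
  exact ModuleCat.shortComplex_shortExact _ hex Subtype.val_injective (Submodule.mkQ_surjective I)

/-- **Lifting the homothety along `R → R/I`.** `c • 𝟙 (R/I)` lifts to a map `R/I → R` iff
`c ∈ I + ann(I)`: a lift `ψ` yields `r := ψ 1̄` with `I r = 0` (as `ψ` vanishes on `Ī = 0`) and
`r̄ = c̄`; conversely `s̄ ↦ s r` is well defined and lifts `c • 𝟙`. [this work; KERNEL-g22 §2 (a)] -/
theorem exists_lift_smul_iff (c : R) :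
    (∃ ψ : ModuleCat.of R (R ⧸ I) ⟶ ModuleCat.of R R, ψ ≫ ModuleCat.ofHom I.mkQ = c • 𝟙 _) ↔
      c ∈ I ⊔ I.annihilator := by
  constructor
  · rintro ⟨ψ, hψ⟩
    set r : R := ψ.hom (I.mkQ 1) with hr
    have hψg : ∀ q : R ⧸ I, I.mkQ (ψ.hom q) = c • q := by
      intro q
      have h := congrArg (fun φ => φ.hom q) hψ
      simpa [ModuleCat.hom_comp] using h
    -- `r - c ∈ I`
    have h1 : r - c ∈ I := by
      have h := hψg (I.mkQ 1)
      rw [← hr, Submodule.mkQ_apply, Submodule.mkQ_apply, ← Submodule.Quotient.mk_smul,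
        smul_eq_mul, mul_one, Submodule.Quotient.eq] at h
      exact h
    -- `r ∈ ann I`: for `i ∈ I`, `r i = i r = i ψ(1̄) = ψ(ī) = ψ 0 = 0`
    have h2 : r ∈ I.annihilator := by
      rw [Submodule.mem_annihilator]
      intro i hi
      have hq : i • (I.mkQ 1 : R ⧸ I) = 0 := by
        rw [Submodule.mkQ_apply, ← Submodule.Quotient.mk_smul, smul_eq_mul, mul_one,
          Submodule.Quotient.mk_eq_zero]
        exact hi
      rw [smul_eq_mul, mul_comm, ← smul_eq_mul, hr, ← map_smul, hq, map_zero]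
    have hc : c = -(r - c) + r := by ring
    rw [hc]
    exact Submodule.add_mem_sup (I.neg_mem h1) h2
  · intro hc
    obtain ⟨i, hi, r, hr, hic⟩ := Submodule.mem_sup.mp hc
    rw [Submodule.mem_annihilator] at hr
    -- the lift `s̄ ↦ s • r`, well defined since `I r = 0`
    have hwd : I ≤ LinearMap.ker (LinearMap.toSpanSingleton R R r) := by
      intro j hj
      rw [LinearMap.mem_ker, LinearMap.toSpanSingleton_apply, smul_eq_mul, mul_comm, ← smul_eq_mul]
      exact hr j hj
    refine ⟨ModuleCat.ofHom (I.liftQ (LinearMap.toSpanSingleton R R r) hwd), ?_⟩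
    apply ModuleCat.hom_ext
    apply Submodule.linearMap_qext
    apply LinearMap.ext
    intro s
    change I.mkQ (I.liftQ (LinearMap.toSpanSingleton R R r) hwd (I.mkQ s)) = c • I.mkQ s
    rw [Submodule.mkQ_apply, Submodule.mkQ_apply, Submodule.liftQ_apply,
      LinearMap.toSpanSingleton_apply, ← Submodule.Quotient.mk_smul, Submodule.Quotient.eq]
    have hs : s • r - c • s = -(s * i) := by
      rw [smul_eq_mul, smul_eq_mul, ← hic]; ring
    rw [hs]
    exact I.neg_mem (I.mul_mem_left s hi)

/-- Every `c ∈ I + ann(I)` kills `Extⁱ(R/I, N)` for all `R`-modules `N` and all `i ≥ 1`: the lift of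
`c • 𝟙` factors the homothety of `R/I` through the free module `R`. [this work; folklore] -/
theorem smul_ext_quotient_eq_zero_of_mem_sup_annihilator {c : R} (hc : c ∈ I ⊔ I.annihilator)
    {N : ModuleCat.{u} R} {i : ℕ} (hi : 1 ≤ i) (e : Ext.{u} (ModuleCat.of R (R ⧸ I)) N i) :
    c • e = 0 := by
  obtain ⟨ψ, hψ⟩ := (exists_lift_smul_iff I c).mpr hc
  haveI : Projective (ModuleCat.of R R) :=
    (IsProjective.iff_projective (R := R) R).mp inferInstance
  exact smul_ext_eq_zero_of_comp_eq_smul_id ψ (ModuleCat.ofHom I.mkQ) hψ hi e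

/-- **Splitting criterion for `Q(I)`.** `c • [Q(I)] = 0` in `Ext¹(R/I, I)` iff `c ∈ I + ann(I)`.
[this work; folklore] -/
theorem smul_extClass_eq_zero_iff_mem_sup_annihilator (c : R) :
    c • (quotientSeq_shortExact I).extClass = 0 ↔ c ∈ I ⊔ I.annihilator := by
  constructor
  · intro h
    exact (exists_lift_smul_iff I c).mp
      (exists_comp_eq_smul_id_X₃_of_smul_extClass_eq_zero (quotientSeq_shortExact I) h)
  · intro hc
    exact smul_ext_quotient_eq_zero_of_mem_sup_annihilator I hc le_rfl _

/-- **The cyclic ceiling.** If `I` is finitely generated and `c ∈ ca¹(R)` (so `c` kills `Ext¹(M, N)`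
for all finitely generated `M`, `N`), then `c ∈ I + ann(I)` (apply the splitting criterion to
`[Q(I)] ∈ Ext¹(R/I, I)`). [this work; KERNEL-g22 THEOREM 22.2 (a)] -/
theorem mem_sup_annihilator_of_mem_cohomologyAnnihilatorOfDegree_one (hI : I.FG) {c : R}
    (hc : c ∈ cohomologyAnnihilatorOfDegree R 1) : c ∈ I ⊔ I.annihilator := by
  haveI : Module.Finite R (ModuleCat.of R I) := Module.Finite.iff_fg.mpr hI
  haveI : Module.Finite R (ModuleCat.of R (R ⧸ I)) :=
    Module.Finite.of_surjective I.mkQ (Submodule.mkQ_surjective I)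
  exact (smul_extClass_eq_zero_iff_mem_sup_annihilator I c).mp
    (smul_eq_zero_of_mem_cohomologyAnnihilatorOfDegree hc le_rfl _)

/-- For a noetherian ring, `ca¹(R) ≤ ⨅_J (J ⊔ ann J)`. [this work] -/
theorem cohomologyAnnihilatorOfDegree_one_le_iInf_sup_annihilator [IsNoetherianRing R] :
    cohomologyAnnihilatorOfDegree R 1 ≤ ⨅ J : Ideal R, J ⊔ J.annihilator :=
  le_iInf fun J => fun _ hc =>
    mem_sup_annihilator_of_mem_cohomologyAnnihilatorOfDegree_one J (IsNoetherian.noetherian J) hc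

/-- Contrapositive form used for `R = k[x,y]/(x,y)³` with `I = (x)`, `c = y` (there
`ann(x) = (x,y)²`, so `y ∉ (x) + ann(x)`): an element outside `I + ann(I)` for one finitely generated
ideal `I` is not in `ca¹(R)`. [this work; KERNEL-g22 THEOREM 22.2 (a)] -/
theorem not_mem_cohomologyAnnihilatorOfDegree_one_of_not_mem_sup_annihilator (hI : I.FG) {c : R}
    (hc : c ∉ I ⊔ I.annihilator) : c ∉ cohomologyAnnihilatorOfDegree R 1 :=
  fun h => hc (mem_sup_annihilator_of_mem_cohomologyAnnihilatorOfDegree_one I hI h)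

end Summit.ResolutionOfSingularities.ResolutionOfSingularities.Theorems.NoZeno.CyclicCeiling
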